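import Literature.AlgebraicGeometry.Frobenioids.PrimesEquivWeak
import Literature.AlgebraicGeometry.Frobenioids.Thm42PrimaryStepsGeneralWeak
import HarnessLib

/-!
# [FrdI] Theorem 4.2 (ii) AS TYPED — the family `Ψ^Prime` — for WEAKLY perf-factorial divisor monoids,
# Frobenioids not of perfect type, MODULO ONLY "`Ψ`, `Ψ⁻¹` preserve pre-steps"

Mochizuki, *The geometry of Frobenioids I: the general theory*, Kyushu J. Math. **62** (2008) 293–400, §4,
Theorem 4.2 (ii), statement pp. 77–78, proof p. 80 (kurims) [cite: MochizukiFrdI2008, Thm. 4.2 (ii) p.77].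

PROOF-ONLY file (cell abc-iut, layer L1, node `FrdI:Thm4.2`; seat abc-iut-L1-t12, row «Thm. 4.2 chain over
`IsPerfFactorialWeak`», L1-lead R129).  Verbatim ports with `Objectwise IsPerfFactorial` replaced by
`Objectwise IsPerfFactorialWeak` (Def. 2.4 (i) (a)(b)(c) + (d_ord) + (d_res); printed case via `IsPerfFactorial.weak`):
* `PreFrobenioid.existsUnique_primesEquiv_family'_weak` — the unique family `e_A : Prime(Φ₁(A)) ≃ Prime(Φ₂(Ψ A))`
  with clauses (a), (b) of the typed statement, for Frobenioids of isotropic type (no perfect-type hypothesis) given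
  that `Ψ` preserves steps and `Ψ`, `Ψ⁻¹` preserve pre-steps and primary pre-steps — port of
  `existsUnique_primesEquiv_family'` (`Thm42iiGeneral.lean`, seats abc-iut-L1-t14 / w5-d162) over
  `existsUnique_primesEquiv_weak` and `IsPerfFactorialWeak.isPrimary_mul_iff_exists_common_prime` (abc-iut-L2-d2);
* `FrdI.T42.thm42ii_ofFunctor_of_preservesPreSteps_weak` — the typed `PreFrobenioidData.Thm42ii` for Frobenioids
  NOT of perfect type with `Φ_i` weakly perf-factorial, under `Thm42Setting`, MODULO ONLY "`Ψ`, `Ψ⁻¹` preserve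
  pre-steps" (Thm. 3.4 (ii)): primary pre-steps along `Ψ`, `Ψ⁻¹` by Thm. 4.2 (i) through the perfections
  (`isPrimaryPreStep_map_of_preservesPreSteps_weak`, `Thm42PrimaryStepsGeneralWeak.lean`);
* `FrdI.T42.thm42ii_ofFunctor_of_isOfFSMFFType2024_weak` — over the author's revised (2024) FSMFF bases.
No new definitions; no landed declaration touched; nothing of the paper restated or strengthened.  HONEST FRAMING:
classical [FrdI] §4 algebra; nothing here bears on [IUTchIII] Cor. 3.12.
-/

namespace Literature.AlgebraicGeometry.Frobenioids

open CategoryTheory Opposite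

namespace PreFrobenioid

universe w v v' u u' w₂ v₂ v₂' u₂ u₂'

variable {D : Type u} [Category.{v} D] {Φ : Dᵒᵖ ⥤ CommMonCat.{w}}
  {C : Type u'} [Category.{v'} C] {F : C ⥤ ElemFrobenioid Φ}

variable {D₂ : Type u₂} [Category.{v₂} D₂] {Φ₂ : D₂ᵒᵖ ⥤ CommMonCat.{w₂}}
  {C₂ : Type u₂'} [Category.{v₂'} C₂] {F₂ : C₂ ⥤ ElemFrobenioid Φ₂} (Ψ : C ≌ C₂)

set_option backward.isDefEq.respectTransparency false in
/-- **Theorem 4.2 (ii), the family `Ψ^Prime`, weakly perf-factorial divisor monoids, no perfect-type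
hypothesis** (FrdI pp. 77–80): for Frobenioids of isotropic type and an equivalence `Ψ` such that `Ψ` preserves
steps and `Ψ`, `Ψ⁻¹` preserve pre-steps and primary pre-steps (Thm. 3.4 (ii), Thm. 4.2 (i)), there is a UNIQUE family
of bijections `e A : Prime(Φ₁(A)) ≃ Prime(Φ₂(Ψ A))` with, for every `𝔭 ∈ Prime(Φ₁(A))`: (a) for every co-angular
pre-step `φ : A → B`, `Div(φ) ∈ Φ₁(A)_𝔭 ⟺ Div(Ψ φ) ∈ Φ₂(Ψ A)_{e A 𝔭}`; (b) for every co-angular pre-step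
`ψ : B → A`, `ψ_*Div(ψ) ∈ Φ₁(A)_𝔭 ⟺ Ψ(ψ)_*Div(Ψ ψ) ∈ Φ₂(Ψ A)_{e A 𝔭}`.  Port of `existsUnique_primesEquiv_family'`.
[cite: MochizukiFrdI2008, Thm. 4.2 (ii) p.77] -/
theorem existsUnique_primesEquiv_family'_weak (hF : IsFrobenioid F) (hF₂ : IsFrobenioid F₂)
    (histr : IsOfIsotropicType F) (histr₂ : IsOfIsotropicType F₂)
    (hpf : Objectwise (fun M _ => IsPerfFactorialWeak M) Φ)
    (hpf₂ : Objectwise (fun M _ => IsPerfFactorialWeak M) Φ₂)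
    (hstep : ∀ ⦃X Y : C⦄ (φ : X ⟶ Y), IsStep F φ → IsStep F₂ (Ψ.functor.map φ))
    (hpre : ∀ ⦃X Y : C⦄ (φ : X ⟶ Y), IsPreStep F φ → IsPreStep F₂ (Ψ.functor.map φ))
    (hpre' : ∀ ⦃X Y : C₂⦄ (φ : X ⟶ Y), IsPreStep F₂ φ → IsPreStep F (Ψ.inverse.map φ))
    (hprim : ∀ ⦃X Y : C⦄ (φ : X ⟶ Y), IsPrimaryPreStep F φ → IsPrimaryPreStep F₂ (Ψ.functor.map φ))
    (hprim' : ∀ ⦃X Y : C₂⦄ (φ : X ⟶ Y), IsPrimaryPreStep F₂ φ → IsPrimaryPreStep F (Ψ.inverse.map φ)) :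
    ∃! e : ∀ A : C, Primes (Φ.obj (op (baseObj F A))) ≃ Primes (Φ₂.obj (op (baseObj F₂ (Ψ.functor.obj A)))),
      ∀ (A : C) (𝔭 : Primes (Φ.obj (op (baseObj F A)))),
        (∀ ⦃B : C⦄ (φ : A ⟶ B), IsCoAngularPreStep F φ →
            (Div F φ ∈ 𝔭.submonoid ↔ Div F₂ (Ψ.functor.map φ) ∈ (e A 𝔭).submonoid)) ∧
        ∀ ⦃B : C⦄ (ψ : B ⟶ A), IsCoAngularPreStep F ψ →
          ((∃ y ∈ 𝔭.submonoid, pull Φ (Base F ψ) y = Div F ψ) ↔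
            ∃ y ∈ (e A 𝔭).submonoid,
              pull Φ₂ (Base F₂ (Ψ.functor.map ψ)) y = Div F₂ (Ψ.functor.map ψ)) := by
  have hP := hF.isPreFrobenioid
  have hP₂ := hF₂.isPreFrobenioid
  have H := fun A : C => existsUnique_primesEquiv_weak Ψ hF hF₂ histr histr₂ hpf hpf₂ hpre hpre' A
    (fun E ε hε => hprim ε hε) (fun Z ξ hξ => hprim' ξ hξ)
  choose e he using fun A => (H A).exists
  have clauseB : ∀ (A : C) (𝔭 : Primes (Φ.obj (op (baseObj F A)))) ⦃B : C⦄ (ψ : B ⟶ A),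
      IsCoAngularPreStep F ψ →
        ((∃ y ∈ 𝔭.submonoid, pull Φ (Base F ψ) y = Div F ψ) ↔
          ∃ y ∈ (e A 𝔭).submonoid,
            pull Φ₂ (Base F₂ (Ψ.functor.map ψ)) y = Div F₂ (Ψ.functor.map ψ)) := by
    intro A 𝔭 B ψ hψ
    haveI : IsIso (Base F ψ) := hψ.2.2
    have hΨψ : IsPreStep F₂ (Ψ.functor.map ψ) := hpre ψ hψ.2
    haveI : IsIso (Base F₂ (Ψ.functor.map ψ)) := hΨψ.2
    by_cases hiso : IsIso ψ
    · refine ⟨fun _ => ⟨1, one_mem _, ?_⟩, fun _ => ⟨1, one_mem _, ?_⟩⟩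
      · rw [map_one]; exact (isIsometry_of_isIso F₂ hP₂ (Ψ.functor.map ψ)).symm
      · rw [map_one]; exact (isIsometry_of_isIso F hP ψ).symm
    · have hst : IsStep F ψ := ⟨hψ.2, hiso⟩
      have hst₂ : IsStep F₂ (Ψ.functor.map ψ) := hstep ψ hst
      have hL : (∃ y ∈ 𝔭.submonoid, pull Φ (Base F ψ) y = Div F ψ) ↔
          invDiv F ψ hψ.2.2 ∈ 𝔭.carrier := by
        constructor
        · rintro ⟨y, hy, hyx⟩
          have hy' : y = invDiv F ψ hψ.2.2 :=
            pull_injective_of_isIso Φ (Base F ψ) (by rw [hyx, pull_invDiv])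
          rcases (𝔭.mem_submonoid_iff' y).mp hy with h1 | h1
          · exact absurd (by rw [← hyx, h1, map_one]) (div_ne_one_of_isStep histr hst)
          · exact hy' ▸ h1
        · exact fun h => ⟨_, Submonoid.subset_closure h, pull_invDiv ψ hψ.2.2⟩
      have hR : (∃ y ∈ (e A 𝔭).submonoid,
            pull Φ₂ (Base F₂ (Ψ.functor.map ψ)) y = Div F₂ (Ψ.functor.map ψ)) ↔
          invDiv F₂ (Ψ.functor.map ψ) hΨψ.2 ∈ (e A 𝔭).carrier := by
        constructor
        · rintro ⟨y, hy, hyx⟩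
          have hy' : y = invDiv F₂ (Ψ.functor.map ψ) hΨψ.2 :=
            pull_injective_of_isIso Φ₂ (Base F₂ (Ψ.functor.map ψ)) (by rw [hyx, pull_invDiv])
          rcases ((e A 𝔭).mem_submonoid_iff' y).mp hy with h1 | h1
          · exact absurd (by rw [← hyx, h1, map_one]) (div_ne_one_of_isStep histr₂ hst₂)
          · exact hy' ▸ h1
        · exact fun h => ⟨_, Submonoid.subset_closure h, pull_invDiv _ hΨψ.2⟩
      rw [hL, hR]
      constructor
      · intro h
        exact he A ψ (isPrimaryPreStep_of_isPrimary_invDiv hψ.2 h.1) 𝔭 h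
      · intro h
        have hprimψ : IsPrimaryPreStep F ψ :=
          isPrimaryPreStep_of_map Ψ hP hprim' (isPrimaryPreStep_of_isPrimary_invDiv hΨψ h.1)
        let 𝔮 : Primes (Φ.obj (op (baseObj F A))) := Quotient.mk _ ⟨_, isPrimary_invDiv hprimψ⟩
        have hq : invDiv F ψ hψ.2.2 ∈ 𝔮.carrier := mem_carrier_mk_of_isPrimary _
        have h2 := he A ψ hprimψ 𝔮 hq
        have h3 : e A 𝔮 = e A 𝔭 := Primes.eq_of_mem_carrier h2 h
        rwa [(e A).injective h3] at hq
  have clauseA : ∀ (A : C) (𝔭 : Primes (Φ.obj (op (baseObj F A)))) ⦃B : C⦄ (φ : A ⟶ B),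
      IsCoAngularPreStep F φ →
        (Div F φ ∈ 𝔭.submonoid ↔ Div F₂ (Ψ.functor.map φ) ∈ (e A 𝔭).submonoid) := by
    intro A 𝔭 B φ hφ
    by_cases hiso : IsIso φ
    · rw [show Div F φ = 1 from isIsometry_of_isIso F hP φ,
        show Div F₂ (Ψ.functor.map φ) = 1 from isIsometry_of_isIso F₂ hP₂ _]
      exact ⟨fun _ => one_mem _, fun _ => one_mem _⟩
    have hst : IsStep F φ := ⟨hφ.2, hiso⟩
    have hst₂ : IsStep F₂ (Ψ.functor.map φ) := hstep φ hst
    have fwd : ∀ 𝔮 : Primes (Φ.obj (op (baseObj F A))), Div F φ ∈ 𝔮.carrier →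
        Div F₂ (Ψ.functor.map φ) ∈ (e A 𝔮).carrier := by
      intro 𝔮 hφ𝔮
      have hφp : IsPrimaryPreStep F φ := ⟨hφ.2, hφ𝔮.1⟩
      obtain ⟨E, ε, hε, hε𝔮⟩ := exists_isPrimaryPreStep_invDiv_mem hF A 𝔮
      haveI : IsIso (Base F ε) := hε.1.2
      have hεst : IsStep F ε := hε.isStep hP
      have hcomp : IsPrimaryPreStep F (ε ≫ φ) := by
        refine ⟨IsPreStep.comp F hε.1 hφ.2, ?_⟩
        rw [div_comp_of_isLinear ε hφ.2.1, ← pull_invDiv ε hε.1.2, ← map_mul]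
        exact (isPrimary_pull_iff (Base F ε) _).mpr
          (((hpf _).isPrimary_mul_iff_exists_common_prime hφ𝔮.1 hε𝔮.1).mpr ⟨𝔮, hφ𝔮, hε𝔮⟩)
      have hc₂ : IsPrimaryPreStep F₂ (Ψ.functor.map ε ≫ Ψ.functor.map φ) := by
        rw [← Functor.map_comp]; exact hprim _ hcomp
      have hφ₂ : IsPrimaryPreStep F₂ (Ψ.functor.map φ) := hprim φ hφp
      have hΨε : IsPrimaryPreStep F₂ (Ψ.functor.map ε) := hprim ε hε
      haveI : IsIso (Base F₂ (Ψ.functor.map ε)) := hΨε.1.2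
      have hprod : IsPrimary (Div F₂ (Ψ.functor.map φ) * invDiv F₂ (Ψ.functor.map ε) hΨε.1.2) := by
        have h1 := hc₂.2
        rw [div_comp_of_isLinear (Ψ.functor.map ε) hφ₂.1.1, ← pull_invDiv (Ψ.functor.map ε) hΨε.1.2,
          ← map_mul] at h1
        exact (isPrimary_pull_iff (Base F₂ (Ψ.functor.map ε)) _).mp h1
      obtain ⟨𝔮₂, hφ𝔮₂, hε𝔮₂⟩ := ((hpf₂ _).isPrimary_mul_iff_exists_common_prime hφ₂.2
        (isPrimary_invDiv hΨε)).mp hprod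
      have hε' := he A ε hε 𝔮 hε𝔮
      rwa [Primes.eq_of_mem_carrier hε𝔮₂ hε'] at hφ𝔮₂
    constructor
    · intro h
      rcases (𝔭.mem_submonoid_iff' _).mp h with h1 | h1
      · exact absurd h1 (div_ne_one_of_isStep histr hst)
      · exact Submonoid.subset_closure (fwd 𝔭 h1)
    · intro h
      rcases ((e A 𝔭).mem_submonoid_iff' _).mp h with h1 | h1
      · exact absurd h1 (div_ne_one_of_isStep histr₂ hst₂)
      · have hφp : IsPrimaryPreStep F φ := isPrimaryPreStep_of_map Ψ hP hprim' ⟨hpre φ hφ.2, h1.1⟩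
        let 𝔮 : Primes (Φ.obj (op (baseObj F A))) := Quotient.mk _ ⟨_, hφp.2⟩
        have hq : Div F φ ∈ 𝔮.carrier := mem_carrier_mk_of_isPrimary _
        have h3 : e A 𝔮 = e A 𝔭 := Primes.eq_of_mem_carrier (fwd 𝔮 hq) h1
        rw [(e A).injective h3] at hq
        exact Submonoid.subset_closure hq
  refine ⟨e, fun A 𝔭 => ⟨clauseA A 𝔭, clauseB A 𝔭⟩, ?_⟩
  intro e' he'
  funext A
  refine (H A).unique ?_ (he A)
  intro E ε hε 𝔭 hε𝔭
  haveI : IsIso (Base F ε) := hε.1.2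
  have hΨε := hprim ε hε
  haveI : IsIso (Base F₂ (Ψ.functor.map ε)) := hΨε.1.2
  have hco : IsCoAngularPreStep F ε :=
    ⟨isCoAngular_of_isIsotropic_codomains F ε fun Z _ => histr Z, hε.1⟩
  obtain ⟨y, hy, hyx⟩ := ((he' A 𝔭).2 ε hco).mp ⟨_, Submonoid.subset_closure hε𝔭, pull_invDiv ε hε.1.2⟩
  have hy' : y = invDiv F₂ (Ψ.functor.map ε) hΨε.1.2 :=
    pull_injective_of_isIso Φ₂ (Base F₂ (Ψ.functor.map ε)) (by rw [hyx, pull_invDiv])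
  rcases ((e' A 𝔭).mem_submonoid_iff' y).mp hy with h1 | h1
  · exact absurd (by rw [← hyx, h1, map_one])
      (div_ne_one_of_isStep histr₂ (hstep ε (hε.isStep hP)))
  · exact hy' ▸ h1

end PreFrobenioid

/-! ### Theorem 4.2 (ii) as typed, Frobenioids not of perfect type, weak hypothesis -/

namespace FrdI.T42

open PreFrobenioidData

universe w v v' u u'

variable {D₁ : Type u} [Category.{v} D₁] {Φ₁ : D₁ᵒᵖ ⥤ CommMonCat.{w}} {C₁ : Type u'} [Category.{v'} C₁]
  {D₂ : Type u} [Category.{v} D₂] {Φ₂ : D₂ᵒᵖ ⥤ CommMonCat.{w}} {C₂ : Type u'} [Category.{v'} C₂]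
  {F₁ : C₁ ⥤ ElemFrobenioid Φ₁} {F₂ : C₂ ⥤ ElemFrobenioid Φ₂} (Ψ : C₁ ≌ C₂)

/-- **Theorem 4.2 (ii) AS TYPED (`PreFrobenioidData.Thm42ii`), for Frobenioids with `Φ_i` WEAKLY perf-factorial,
NOT assumed of perfect type, with no base hypothesis beyond print's standard type, MODULO "`Ψ` and `Ψ⁻¹` preserve
pre-steps"** (Thm. 3.4 (ii)): under `Thm42Setting` there is a UNIQUE family of bijections
`Ψ^Prime_A : Prime(Φ₁(A)) ≃ Prime(Φ₂(Ψ A))` with clauses (a) and (b).  Steps from pre-steps (`Ψ` reflects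
isomorphisms); primary pre-steps along `Ψ` and `Ψ⁻¹` by Thm. 4.2 (i) through the perfections
(`isPrimaryPreStep_map_of_preservesPreSteps_weak` / `…inverse_map…`); then `existsUnique_primesEquiv_family'_weak`.
Weak-hypothesis twin of `thm42ii_ofFunctor_of_preservesPreSteps` (seat abc-iut-w4-d105).
[cite: MochizukiFrdI2008, Thm. 4.2 (ii) p.77] -/
theorem thm42ii_ofFunctor_of_preservesPreSteps_weak (hF₁ : PreFrobenioid.IsFrobenioid F₁)
    (hF₂ : PreFrobenioid.IsFrobenioid F₂)
    (hpf₁ : Objectwise (fun M _ => IsPerfFactorialWeak M) Φ₁)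
    (hpf₂ : Objectwise (fun M _ => IsPerfFactorialWeak M) Φ₂)
    (hpre : ∀ ⦃X Y : C₁⦄ (φ : X ⟶ Y), PreFrobenioid.IsPreStep F₁ φ → PreFrobenioid.IsPreStep F₂ (Ψ.functor.map φ))
    (hpre' : ∀ ⦃X Y : C₂⦄ (φ : X ⟶ Y), PreFrobenioid.IsPreStep F₂ φ → PreFrobenioid.IsPreStep F₁ (Ψ.inverse.map φ)) :
    (ofFunctor Φ₁ F₁).Thm42ii (ofFunctor Φ₂ F₂) Ψ := by
  intro hT
  obtain ⟨hi₁, hi₂, -, -, -, -⟩ := of_thm42Setting hT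
  have hprim : ∀ ⦃X Y : C₁⦄ (φ : X ⟶ Y), PreFrobenioid.IsPrimaryPreStep F₁ φ →
      PreFrobenioid.IsPrimaryPreStep F₂ (Ψ.functor.map φ) :=
    isPrimaryPreStep_map_of_preservesPreSteps_weak Ψ hF₁ hF₂ hpf₁ hpf₂ hpre hpre' hT
  have hprim' : ∀ ⦃X Y : C₂⦄ (φ : X ⟶ Y), PreFrobenioid.IsPrimaryPreStep F₂ φ →
      PreFrobenioid.IsPrimaryPreStep F₁ (Ψ.inverse.map φ) :=
    isPrimaryPreStep_inverse_map_of_preservesPreSteps_weak Ψ hF₁ hF₂ hpf₁ hpf₂ hpre hpre' hT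
  obtain ⟨e, he, hu⟩ := PreFrobenioid.existsUnique_primesEquiv_family'_weak Ψ hF₁ hF₂ hi₁ hi₂ hpf₁ hpf₂
    (fun _ _ φ hφ => ⟨hpre φ hφ.1, fun h => hφ.2
      (by haveI := h; exact Ψ.fullyFaithfulFunctor.isIso_of_isIso_map φ)⟩)
    hpre hpre' hprim hprim'
  refine ⟨e, fun A 𝔭 => ⟨fun B φ hφ => (he A 𝔭).1 φ ((ofFunctor_isCoAngularPreStep F₁ φ).mp hφ),
    fun B ψ hψ => (he A 𝔭).2 ψ ((ofFunctor_isCoAngularPreStep F₁ ψ).mp hψ)⟩, fun e' he' => hu e' ?_⟩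
  intro A 𝔭
  exact ⟨fun B φ hφ => (he' A 𝔭).1 φ ((ofFunctor_isCoAngularPreStep F₁ φ).mpr hφ),
    fun B ψ hψ => (he' A 𝔭).2 ψ ((ofFunctor_isCoAngularPreStep F₁ ψ).mpr hψ)⟩

/-- **Theorem 4.2 (ii) AS TYPED over FSMFF-type bases in the author's revised (2024) sense**, for Frobenioids with
`Φ_i` WEAKLY perf-factorial, NOT assumed of perfect type (Thm. 3.4 (ii) over such bases:
`FrdI.isPreStep_map_of_quasiIsotropic_of_isOfFSMFFType2024`, seat abc-iut-L1-t11).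
[cite: MochizukiFrdI2008, Thm. 4.2 (ii) p.77] [cite: MochizukiFrdIComments2024, (28) p.3] -/
theorem thm42ii_ofFunctor_of_isOfFSMFFType2024_weak (hF₁ : PreFrobenioid.IsFrobenioid F₁)
    (hF₂ : PreFrobenioid.IsFrobenioid F₂)
    (hpf₁ : Objectwise (fun M _ => IsPerfFactorialWeak M) Φ₁)
    (hpf₂ : Objectwise (fun M _ => IsPerfFactorialWeak M) Φ₂)
    (hD₁ : IsOfFSMFFType2024 D₁) (hD₂ : IsOfFSMFFType2024 D₂) :
    (ofFunctor Φ₁ F₁).Thm42ii (ofFunctor Φ₂ F₂) Ψ := fun hT =>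
  thm42ii_ofFunctor_of_preservesPreSteps_weak Ψ hF₁ hF₂ hpf₁ hpf₂
    (fun _ _ _ h => FrdI.isPreStep_map_of_quasiIsotropic_of_isOfFSMFFType2024 hF₁ hF₂
      hT.standard.1.quasiIsotropic hT.standard.2.quasiIsotropic hD₁ hD₂ Ψ h)
    (fun _ _ _ h => FrdI.isPreStep_map_of_quasiIsotropic_of_isOfFSMFFType2024 hF₂ hF₁
      hT.standard.2.quasiIsotropic hT.standard.1.quasiIsotropic hD₂ hD₁ Ψ.symm h) hT

end FrdI.T42

end Literature.AlgebraicGeometry.Frobenioids
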